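import Literature.Analysis.Calculus.SmoothAlongExp
import Mathlib.Analysis.Calculus.IteratedDeriv.Lemmas
import Mathlib.Analysis.Calculus.ContDiff.Bounds
import HarnessLib

/-!
# Derivatives along the right-multiplication flow `s ↦ M · exp (s X)` on a real Banach algebra

Topic `Analysis/Calculus`; namespace `Literature.Analysis.Calculus`.  One plumbing definition with body (`derivAlong`) and proved
theorems; no named fact, no instance, no notation, no `sorry`.  Setting (as ★ `SmoothAlongExp`): `A` a real Banach algebra
(`[NormedRing A] [NormedAlgebra ℝ A] [CompleteSpace A]`; in the applications `A = M_N(L ⊗ ℝ)`), `exp = NormedSpace.exp`, values in a real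
normed space `F` (`ℂ` downstream), `Θ : A → F`.

The LEFT-INVARIANT vector field generated by `X ∈ A` is `M ↦ M · X`; its flow through `M` is `s ↦ M · exp (s X)`.  We set
`derivAlong X Θ M := DΘ(M)[M · X]` (`fderiv ℝ Θ M (M * X)`), a plain function `(A → F) → (A → F)` iterated by `Nat.iterate`, and prove:

* §1 pointwise linearity (`derivAlong_add∕_sub∕_neg∕_smul∕_zero`), support (`support_derivAlong_subset`, `tsupport_derivAlong_subset`,
  `HasCompactSupport.derivAlong`, and the `Nat.iterate` forms), smoothness (`contDiff_derivAlong`, `contDiff_iterate_derivAlong`);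
* §2 **the flow identity**: `HasDerivAt (fun s => Θ (M * exp (s • X))) (derivAlong X Θ (M * exp (t • X))) t` for `Θ ∈ C¹`
  (`hasDerivAt_comp_mul_exp_smul`; Mathlib `hasDerivAt_exp_smul_const'` + the chain rule), hence
  **`iteratedDeriv n (fun s => Θ (M * exp (s • X))) t = ((derivAlong X)^[n] Θ) (M * exp (t • X))`** for smooth `Θ` (`iteratedDeriv_comp_mul_exp_smul`)
  and `contDiff_comp_mul_exp_smul`;
* §3 **uniform bounds**: for `Θ` smooth with compact support, every `‖iteratedFDeriv ℝ k ((derivAlong X)^[n] Θ) M‖` is bounded uniformly in `M`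
  (`exists_forall_norm_iteratedFDeriv_iterate_derivAlong_le`, `exists_forall_norm_iterate_derivAlong_le`).

This is brick B3 of the road «DM∞» (F0∕P3, `F0/P3/p03/CENSUS-DMinf.F0P3p03g8.md`: the archimedean Dixmier–Malliavin factorisation for `U(H)(L⁺ ⊗ ℝ)`,
[DixmierMalliavin1978, §3 Thm. 3.1] in the Lie-group case): step (i) there differentiates `Θ(g · e^{sX})` in `s` along one direction `X` of the Lie algebra,
which is exactly §2; the `M_j`-majorants of the 1-D kernel package are the bounds of §3.  Nothing here is specific to unitary groups; HC_CM is proved only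
modulo the printed citations until rung 0 closes, and this file introduces no debt.

## References
* J. Dixmier, P. Malliavin, *Factorisations de fonctions et de vecteurs indéfiniment différentiables*, Bull. Sci. Math. 102 (1978), §2 Lemme 2.5–2.8,
  §3 Thm. 3.1 (the one-parameter steps `φ(g exp tX)`). [DixmierMalliavin1978]
* A. W. Knapp, *Lie Groups Beyond an Introduction*, 2nd ed. (2002), Chap. I §10 (left-invariant fields `X̃_g = d/dt|₀ g exp tX` on matrix groups). [Knapp2002]
-/

set_option autoImplicit false

noncomputable section

open NormedSpace Filter Set Function
open scoped Topology ContDiff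

namespace Literature.Analysis.Calculus

variable {A : Type*} [NormedRing A] [NormedAlgebra ℝ A] {F : Type*} [NormedAddCommGroup F] [NormedSpace ℝ F]

/-! ## §1 The operator `derivAlong X` -/

/-- **`derivAlong X Θ M = DΘ(M)[M · X]`** — the derivative of `Θ` along the left-invariant vector field `M ↦ M · X` (the generator of the
right-multiplication flow `s ↦ M · exp (s X)`); a plain function, iterated by `Nat.iterate`. [cite: Knapp2002, Chap. I §10] -/
def derivAlong (X : A) (Θ : A → F) : A → F := fun M => fderiv ℝ Θ M (M * X)

/-- unfolding (definitional). [cite: Knapp2002, Chap. I §10] -/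
theorem derivAlong_apply (X : A) (Θ : A → F) (M : A) : derivAlong X Θ M = fderiv ℝ Θ M (M * X) := rfl

/-- `derivAlong X 0 = 0`. [cite: Knapp2002, Chap. I §10] -/
@[simp] theorem derivAlong_zero (X : A) : derivAlong X (0 : A → F) = 0 := by
  funext M
  rw [derivAlong_apply, fderiv_zero, Pi.zero_apply, Pi.zero_apply]
  rfl

/-- pointwise additivity at a point of differentiability. [cite: Knapp2002, Chap. I §10] -/
theorem derivAlong_add_apply (X : A) {Θ₁ Θ₂ : A → F} {M : A} (h₁ : DifferentiableAt ℝ Θ₁ M) (h₂ : DifferentiableAt ℝ Θ₂ M) :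
    derivAlong X (Θ₁ + Θ₂) M = derivAlong X Θ₁ M + derivAlong X Θ₂ M := by
  rw [derivAlong_apply, fderiv_add h₁ h₂]
  rfl

/-- additivity for differentiable functions. [cite: Knapp2002, Chap. I §10] -/
theorem derivAlong_add (X : A) {Θ₁ Θ₂ : A → F} (h₁ : Differentiable ℝ Θ₁) (h₂ : Differentiable ℝ Θ₂) :
    derivAlong X (Θ₁ + Θ₂) = derivAlong X Θ₁ + derivAlong X Θ₂ :=
  funext fun M => derivAlong_add_apply X (h₁ M) (h₂ M)

/-- pointwise homogeneity (real scalars) at a point of differentiability. [cite: Knapp2002, Chap. I §10] -/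
theorem derivAlong_smul_apply (X : A) (c : ℝ) {Θ : A → F} {M : A} (h : DifferentiableAt ℝ Θ M) :
    derivAlong X (c • Θ) M = c • derivAlong X Θ M := by
  rw [derivAlong_apply, fderiv_const_smul h]
  rfl

/-- homogeneity (real scalars) for differentiable functions. [cite: Knapp2002, Chap. I §10] -/
theorem derivAlong_smul (X : A) (c : ℝ) {Θ : A → F} (h : Differentiable ℝ Θ) :
    derivAlong X (c • Θ) = c • derivAlong X Θ :=
  funext fun M => derivAlong_smul_apply X c (h M)

/-- `derivAlong X (−Θ) = −derivAlong X Θ` (no differentiability needed: `fderiv (−Θ) = −fderiv Θ`). [cite: Knapp2002, Chap. I §10] -/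
@[simp] theorem derivAlong_neg (X : A) (Θ : A → F) : derivAlong X (-Θ) = -derivAlong X Θ := by
  funext M
  rw [Pi.neg_apply, derivAlong_apply, derivAlong_apply, fderiv_neg]
  rfl

/-- subtraction for differentiable functions. [cite: Knapp2002, Chap. I §10] -/
theorem derivAlong_sub (X : A) {Θ₁ Θ₂ : A → F} (h₁ : Differentiable ℝ Θ₁) (h₂ : Differentiable ℝ Θ₂) :
    derivAlong X (Θ₁ - Θ₂) = derivAlong X Θ₁ - derivAlong X Θ₂ := by
  rw [sub_eq_add_neg, derivAlong_add X h₁ h₂.neg, derivAlong_neg, ← sub_eq_add_neg]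

/-- **support**: `derivAlong X Θ` vanishes wherever `fderiv ℝ Θ` does. [cite: Knapp2002, Chap. I §10] -/
theorem support_derivAlong_subset (X : A) (Θ : A → F) : support (derivAlong X Θ) ⊆ support (fderiv ℝ Θ) := by
  intro M hM h0
  exact hM (by rw [derivAlong_apply, h0]; rfl)

/-- **`tsupport (derivAlong X Θ) ⊆ tsupport Θ`** (through `tsupport (fderiv ℝ Θ) ⊆ tsupport Θ`). [cite: Knapp2002, Chap. I §10] -/
theorem tsupport_derivAlong_subset (X : A) (Θ : A → F) : tsupport (derivAlong X Θ) ⊆ tsupport Θ :=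
  (closure_mono (support_derivAlong_subset X Θ)).trans (tsupport_fderiv_subset ℝ)

/-- `tsupport ((derivAlong X)^[n] Θ) ⊆ tsupport Θ`. [cite: Knapp2002, Chap. I §10] -/
theorem tsupport_iterate_derivAlong_subset (X : A) (Θ : A → F) (n : ℕ) : tsupport ((derivAlong X)^[n] Θ) ⊆ tsupport Θ := by
  induction n generalizing Θ with
  | zero => exact subset_rfl
  | succ n ih =>
    rw [Function.iterate_succ_apply]
    exact (ih (derivAlong X Θ)).trans (tsupport_derivAlong_subset X Θ)

/-- **compact support is preserved**. [cite: Knapp2002, Chap. I §10] -/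
theorem _root_.HasCompactSupport.derivAlong (X : A) {Θ : A → F} (h : HasCompactSupport Θ) : HasCompactSupport (derivAlong X Θ) :=
  h.mono' ((support_derivAlong_subset X Θ).trans ((subset_tsupport _).trans (tsupport_fderiv_subset ℝ)))

/-- compact support of the iterates. [cite: Knapp2002, Chap. I §10] -/
theorem _root_.HasCompactSupport.iterate_derivAlong (X : A) {Θ : A → F} (h : HasCompactSupport Θ) (n : ℕ) :
    HasCompactSupport ((derivAlong X)^[n] Θ) := by
  induction n with
  | zero => exact h
  | succ n ih =>
    rw [Function.iterate_succ_apply']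
    exact ih.derivAlong X

/-- **smoothness is preserved**: `Θ ∈ C^∞ ⇒ derivAlong X Θ ∈ C^∞` (`fderiv ℝ Θ` is `C^∞`, applied to the smooth field `M ↦ M · X`).
[cite: Knapp2002, Chap. I §10] -/
theorem contDiff_derivAlong (X : A) {Θ : A → F} (hΘ : ContDiff ℝ ∞ Θ) : ContDiff ℝ ∞ (derivAlong X Θ) :=
  (contDiff_infty_iff_fderiv.1 hΘ).2.clm_apply (contDiff_id.mul contDiff_const)

/-- smoothness of the iterates. [cite: Knapp2002, Chap. I §10] -/
theorem contDiff_iterate_derivAlong (X : A) {Θ : A → F} (hΘ : ContDiff ℝ ∞ Θ) (n : ℕ) : ContDiff ℝ ∞ ((derivAlong X)^[n] Θ) := by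
  induction n with
  | zero => exact hΘ
  | succ n ih =>
    rw [Function.iterate_succ_apply']
    exact contDiff_derivAlong X ih

/-- `derivAlong X Θ` is continuous for smooth `Θ`. [cite: Knapp2002, Chap. I §10] -/
theorem continuous_derivAlong (X : A) {Θ : A → F} (hΘ : ContDiff ℝ ∞ Θ) : Continuous (derivAlong X Θ) :=
  (contDiff_derivAlong X hΘ).continuous

/-! ## §2 The flow identity: `d/ds Θ(M · exp (sX)) = (derivAlong X Θ)(M · exp (sX))` -/

variable [CompleteSpace A]

/-- the flow `s ↦ M · exp (s • X)` has derivative `(M · exp (t • X)) · X` at `t` (Mathlib `hasDerivAt_exp_smul_const'`). [cite: Knapp2002, Chap. I §10] -/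
theorem hasDerivAt_mul_exp_smul (M X : A) (t : ℝ) :
    HasDerivAt (fun s : ℝ => M * exp (s • X)) (M * exp (t • X) * X) t := by
  have h := (hasDerivAt_exp_smul_const (𝕂 := ℝ) X t).const_mul M
  rw [← mul_assoc] at h
  exact h

/-- the flow is smooth in `s`. [cite: Knapp2002, Chap. I §10] -/
theorem contDiff_mul_exp_smul (M X : A) : ContDiff ℝ ∞ (fun s : ℝ => M * exp (s • X)) :=
  contDiff_const.mul ((contDiff_iff_contDiffAt.2 fun x => contDiffAt_exp x).comp (contDiff_id.smul contDiff_const))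

/-- **THE FLOW IDENTITY**: for `Θ ∈ C¹`, `s ↦ Θ (M · exp (s • X))` has derivative `(derivAlong X Θ) (M · exp (t • X))` at `t` (chain rule along the flow).
[cite: DixmierMalliavin1978, §3 Thm. 3.1] [cite: Knapp2002, Chap. I §10] -/
theorem hasDerivAt_comp_mul_exp_smul {Θ : A → F} (hΘ : ContDiff ℝ 1 Θ) (M X : A) (t : ℝ) :
    HasDerivAt (fun s : ℝ => Θ (M * exp (s • X))) (derivAlong X Θ (M * exp (t • X))) t := by
  have hd : DifferentiableAt ℝ Θ (M * exp (t • X)) := (hΘ.differentiable one_ne_zero).differentiableAt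
  exact hd.hasFDerivAt.comp_hasDerivAt t (hasDerivAt_mul_exp_smul M X t)

/-- `deriv` form of the flow identity. [cite: Knapp2002, Chap. I §10] -/
theorem deriv_comp_mul_exp_smul {Θ : A → F} (hΘ : ContDiff ℝ 1 Θ) (M X : A) :
    deriv (fun s : ℝ => Θ (M * exp (s • X))) = fun t => derivAlong X Θ (M * exp (t • X)) :=
  funext fun t => (hasDerivAt_comp_mul_exp_smul hΘ M X t).deriv

/-- `s ↦ Θ (M · exp (s • X))` is smooth for smooth `Θ`. [cite: Knapp2002, Chap. I §10] -/
theorem contDiff_comp_mul_exp_smul {Θ : A → F} (hΘ : ContDiff ℝ ∞ Θ) (M X : A) :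
    ContDiff ℝ ∞ (fun s : ℝ => Θ (M * exp (s • X))) :=
  hΘ.comp (contDiff_mul_exp_smul M X)

/-- **ITERATED FLOW IDENTITY**: `dⁿ/dsⁿ Θ(M · exp (sX)) |_{s=t} = ((derivAlong X)^[n] Θ)(M · exp (tX))` for smooth `Θ`.
[cite: DixmierMalliavin1978, §3 Thm. 3.1] [cite: Knapp2002, Chap. I §10] -/
theorem iteratedDeriv_comp_mul_exp_smul {Θ : A → F} (hΘ : ContDiff ℝ ∞ Θ) (n : ℕ) (M X : A) (t : ℝ) :
    iteratedDeriv n (fun s : ℝ => Θ (M * exp (s • X))) t = ((derivAlong X)^[n] Θ) (M * exp (t • X)) := by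
  induction n generalizing Θ t with
  | zero => rw [iteratedDeriv_zero, Function.iterate_zero_apply]
  | succ n ih =>
    rw [iteratedDeriv_succ', deriv_comp_mul_exp_smul (hΘ.of_le (mod_cast le_top)) M X, Function.iterate_succ_apply]
    exact ih (contDiff_derivAlong X hΘ) t

/-- the iterated flow identity as an equality of functions. [cite: Knapp2002, Chap. I §10] -/
theorem iteratedDeriv_comp_mul_exp_smul_eq {Θ : A → F} (hΘ : ContDiff ℝ ∞ Θ) (n : ℕ) (M X : A) :
    iteratedDeriv n (fun s : ℝ => Θ (M * exp (s • X))) = fun t => ((derivAlong X)^[n] Θ) (M * exp (t • X)) :=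
  funext fun t => iteratedDeriv_comp_mul_exp_smul hΘ n M X t

/-- at `t = 0`: `dⁿ/dsⁿ|₀ Θ(M · exp (sX)) = ((derivAlong X)^[n] Θ) M`. [cite: Knapp2002, Chap. I §10] -/
theorem iteratedDeriv_comp_mul_exp_smul_zero {Θ : A → F} (hΘ : ContDiff ℝ ∞ Θ) (n : ℕ) (M X : A) :
    iteratedDeriv n (fun s : ℝ => Θ (M * exp (s • X))) 0 = ((derivAlong X)^[n] Θ) M := by
  rw [iteratedDeriv_comp_mul_exp_smul hΘ n M X 0, zero_smul, exp_zero, mul_one]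

/-! ## §3 Uniform bounds for compactly supported smooth `Θ` -/

omit [CompleteSpace A] in
/-- **UNIFORM BOUNDS**: for `Θ` smooth with compact support, `sup_M ‖Dᵏ((derivAlong X)^[n] Θ)(M)‖ < ∞` for all `k, n` (a continuous compactly supported
function is bounded). [cite: DixmierMalliavin1978, §2 Lemme 2.5] -/
theorem exists_forall_norm_iteratedFDeriv_iterate_derivAlong_le (X : A) {Θ : A → F} (hΘ : ContDiff ℝ ∞ Θ) (hc : HasCompactSupport Θ)
    (k n : ℕ) : ∃ C : ℝ, 0 ≤ C ∧ ∀ M, ‖iteratedFDeriv ℝ k ((derivAlong X)^[n] Θ) M‖ ≤ C := by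
  have hsm : ContDiff ℝ ∞ ((derivAlong X)^[n] Θ) := contDiff_iterate_derivAlong X hΘ n
  have hcs : HasCompactSupport (iteratedFDeriv ℝ k ((derivAlong X)^[n] Θ)) := (hc.iterate_derivAlong X n).iteratedFDeriv k
  have hcont : Continuous (iteratedFDeriv ℝ k ((derivAlong X)^[n] Θ)) :=
    hsm.continuous_iteratedFDeriv (by exact_mod_cast le_top)
  obtain ⟨C, hC⟩ := hcs.exists_bound_of_continuous hcont
  exact ⟨max C 0, le_max_right _ _, fun M => (hC M).trans (le_max_left _ _)⟩

omit [CompleteSpace A] in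
/-- the `k = 0` case: `sup_M ‖((derivAlong X)^[n] Θ)(M)‖ < ∞`. [cite: DixmierMalliavin1978, §2 Lemme 2.5] -/
theorem exists_forall_norm_iterate_derivAlong_le (X : A) {Θ : A → F} (hΘ : ContDiff ℝ ∞ Θ) (hc : HasCompactSupport Θ) (n : ℕ) :
    ∃ C : ℝ, 0 ≤ C ∧ ∀ M, ‖((derivAlong X)^[n] Θ) M‖ ≤ C := by
  obtain ⟨C, hC0, hC⟩ := exists_forall_norm_iteratedFDeriv_iterate_derivAlong_le X hΘ hc 0 n
  exact ⟨C, hC0, fun M => by simpa only [norm_iteratedFDeriv_zero] using hC M⟩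

/-- the flow derivatives are uniformly bounded in `(M, t)`: `‖dⁿ/dsⁿ Θ(M · exp (sX))|_{s=t}‖ ≤ C`. [cite: DixmierMalliavin1978, §2 Lemme 2.5] -/
theorem exists_forall_norm_iteratedDeriv_comp_mul_exp_smul_le (X : A) {Θ : A → F} (hΘ : ContDiff ℝ ∞ Θ) (hc : HasCompactSupport Θ) (n : ℕ) :
    ∃ C : ℝ, 0 ≤ C ∧ ∀ (M : A) (t : ℝ), ‖iteratedDeriv n (fun s : ℝ => Θ (M * exp (s • X))) t‖ ≤ C := by
  obtain ⟨C, hC0, hC⟩ := exists_forall_norm_iterate_derivAlong_le X hΘ hc n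
  exact ⟨C, hC0, fun M t => by rw [iteratedDeriv_comp_mul_exp_smul hΘ n M X t]; exact hC _⟩

end Literature.Analysis.Calculus

end
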